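/-
Copyright (c) 2026 the pub-hodgecm-mathlib formalisation cell (harness21).  Prover seat hodgecm-mathlib-K2E3-p37 (g2), Track B «K2-LIT» ∕ h413 =
`stmt-HodgeConjecture-24833`, line `K2_E3_EllipticInputs`, unit U4 «Keys», PART «U4Keys» socket :182 (U4f-χ₁-ram-one-pos)
`sig_K2E3KeysThmTwoContractingRamifiedCharOnePosDepth` (L4 line-lead K2E3-plan (g5); regime A_pos over the two-depth group `J_e`): brick (iii)^{<}-upper-cover «THE
UPPER SHELLS ARE THE LOWER CELLS OF THE SWAPPED GROUP» — the adapter that feeds K2E3-p34 (g2)'s transport ★ p862617 (`K2E3TwoDepthUpperShellTransport.exists_upperShell_witness_of_exists`)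
and its CM dress (`K2E3TwoDepthUpperShellWitnessCM`) with the witness package of this seat's cover ★ p862713 taken at the SWAPPED tuple `(r₂, s₂; r₁, s₁)` and at the integral
point `ū′ = ū(x∕z, z⁻¹)` of an upper shell `ū(x, z)` (`|z| ≥ 1`).  REPORT-FIRST 2026-09-04.
-/
import Summits.HodgeConjecture.HodgeConjecture.Theorems.K2E3TwoDepthDepthWitnessCover   -- ★ p862713 (this seat): `exists_depth_witness_twoDepth`; brings ★ p862593, ★ D174, ★ p861613 (`div_rel`)
import HarnessLib

/-!
# K2 ∕ E3 «EllipticInputs», unit U4 «Keys» — (U4f-χ₁-ram-one-pos), regime A_pos over `J_e`: THE UPPER SHELLS AS LOWER CELLS OF THE SWAPPED GROUP (model `U(σ, Φ₃)(K)`)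
# «`|z| ≥ 1`, `ū(x,z) ∉ J_e`, `ū(x,z) ∉ P·w·J_e` ⟹ the cover ★ p862713 applies to `ū′ = ū(x∕z, z⁻¹)` for `e^w = (r₂, s₂; r₁, s₁)`: the two letters swap rôles»  [Roche1998 §4; Casselman1995 §6.3]

Cell hodgecm-mathlib, Track B «K2-LIT», crux item H413 = stmt-HodgeConjecture-24833 (route `HCCMUnconditional`, no route verbs); target BY NAME the OPEN tier-0 leaf
`…K2E3EllipticInputs.U4Keys.sig_K2E3KeysThmTwoContractingRamifiedCharOnePosDepth` (U4Keys ED. 8 :182), design D-I at POSITIVE depth over Roche's two-depth group.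
Author K2E3-p37 (g2).  `--supports stmt-HodgeConjecture-24833 --as helper`; THEOREMS ONLY; MODEL level.  NOT THE PAYER.

THE POINT.  An UPPER shell is a lower unipotent `ū = ū(x, z)` with `|z| ≥ 1` that is neither in `J_e` nor in the sharp big cell `P·w·J_e`; ★ p861613 writes `ū = p·w·u(x∕z, 1∕z)`
and K2E3-p34 (g2)'s transport ★ p862617 turns a depth witness for the INTEGRAL lower unipotent `ū′ := ū(x∕z, z⁻¹)` (relation ★ `div_rel`) with respect to the SWAPPED group
`J_{e^w}`, `e^w (i j) = e (rev i) (rev j)`, into the engine's `hwit` datum at `ū`.  This file supplies that witness from the cover ★ p862713, observing that the two side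
conditions trade places under `(x, z) ↦ (x∕z, z⁻¹)`:
* «`ū` off the sharp cell of `e`» `¬(|x∕z| ≤ |ϖ|^{r₁} ∧ (|ϖ|^{s₁})⁻¹ ≤ |z|)`  =  «`ū′ ∉ J_{e^w}`» in entry form `¬(|x∕z| ≤ |ϖ|^{r₁} ∧ |z⁻¹| ≤ |ϖ|^{s₁})`;
* «`ū ∉ J_e`» `¬(|x| ≤ |ϖ|^{r₂} ∧ |z| ≤ |ϖ|^{s₂})`  =  «`ū′` off the sharp cell of `e^w`» `¬(|(x∕z)∕z⁻¹| ≤ |ϖ|^{r₂} ∧ (|ϖ|^{s₂})⁻¹ ≤ |z⁻¹|)`;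
and that the alignment clause of ★ p862713 is swap-invariant.  The membership letter is taken in ★ p862617's spelling `hJgw : k ∈ Jgw ↔ ∀ i j, |k i j| ≤ |ϖ| ^ e (rev i) (rev j)`
with `e := ![![0, r₁, s₁], ![r₂, 0, r₁], ![s₂, r₂, 0]]` and converted to ★ p862713's matrix form at `(r₂, s₂; r₁, s₁)` (`fin_cases`).
* §1 `twoDepth_rev_apply` (the swapped exponent matrix), `mem_iff_of_rev`.
* §2 **`exists_upperShell_witness_package`** — OUTPUT = the `hwit` binder of ★ p862617 `exists_upperShell_witness_of_exists` ∕ of p34's CM dress, with `c ∈ {c₁, c₂}`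
  (`c₁ ∈ 𝔭ᵐ` arbitrary — the CM caller feeds `σ_w((u₁)_w) − 1` so that `σ(1 + c) = (u₁)_w`; `c₂ ∈ 𝔭ᵏ` `σ`-fixed).
HONEST LABEL: HC_CM is proved only modulo the 7 printed citations (2 remaining named inputs: hLiu418 = stmt-HodgeConjecture-24832, h413 = stmt-HodgeConjecture-24833)
until rung 0 closes; count-neutral — this file does NOT pay the leaf; no printed citation is discharged.

## References
* [Roche1998] A. Roche, *Types and Hecke algebras for principal series representations of split reductive p-adic groups*, Ann. Sci. ÉNS (4) 31 (1998), §4.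
* [Casselman1995] W. Casselman, *Introduction to the theory of admissible representations of `p`-adic reductive groups* (1995), §6.3, Prop. 1.3.1.
* [BruhatTits1972] F. Bruhat, J. Tits, *Groupes réductifs sur un corps local I*, Publ. Math. IHÉS 41 (1972), (6.4.9).
* [Serre1979] J.-P. Serre, *Local Fields*, GTM 67 (1979), Ch. II §1.
-/

set_option autoImplicit false
-- the mandated namespace repeats the single-problem summit's segment (`HodgeConjecture.HodgeConjecture`)
set_option linter.dupNamespace false

noncomputable section

open Matrix Literature.NumberTheory.Automorphic Literature.NumberTheory.Automorphic.UnitaryGroup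
open scoped Matrix MatrixGroups WithZero Pointwise

namespace Summit.HodgeConjecture.HodgeConjecture.Cruxes.H413.K2E3TwoDepthUpperShellCover

open Summit.HodgeConjecture.HodgeConjecture.Cruxes.H413

/-! ## §1 The swapped exponent matrix -/

/-- `e^w (i, j) = e (rev i, rev j)` for the two-depth matrix: `(r₁, s₁; r₂, s₂)^w = (r₂, s₂; r₁, s₁)`. [cite: BruhatTits1972, (6.4.9)] -/
theorem twoDepth_rev_apply (r₁ s₁ r₂ s₂ : ℕ) (i j : Fin 3) :
    (![![0, r₁, s₁], ![r₂, 0, r₁], ![s₂, r₂, 0]] : Fin 3 → Fin 3 → ℕ) (Fin.rev i) (Fin.rev j) =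
      (![![0, r₂, s₂], ![r₁, 0, r₂], ![s₁, r₁, 0]] : Fin 3 → Fin 3 → ℕ) i j := by
  fin_cases i <;> fin_cases j <;> rfl

section Valuation

variable {K : Type*} [Field K] [Valued K ℤᵐ⁰] [ValuativeRel K] [(Valued.v : Valuation K ℤᵐ⁰).Compatible]
  (σ : K →+* K) {ϖ : K} {J : Matrix (Fin 3) (Fin 3) K} (hJ : J = (StdForm.antidiagonal 3).over K)
  (hσ : ∀ a, σ (σ a) = a) (hvσ : ∀ a, Valued.v (σ a) = Valued.v a) (hvϖ : Valued.v ϖ = WithZero.exp (-1 : ℤ))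
  (r₁ s₁ r₂ s₂ : ℕ) (Jgw : Subgroup ↥(unitaryGroupOfForm σ J))
  (hJgw : ∀ k, k ∈ Jgw ↔ ∀ i j, Valued.v (((k : GL (Fin 3) K) : Matrix (Fin 3) (Fin 3) K) i j) ≤
    Valued.v ϖ ^ (![![0, r₁, s₁], ![r₂, 0, r₁], ![s₂, r₂, 0]] : Fin 3 → Fin 3 → ℕ) (Fin.rev i) (Fin.rev j))

omit [ValuativeRel K] [(Valued.v : Valuation K ℤᵐ⁰).Compatible] in
include hJgw in
/-- ★ p862617's letter `hJgw` (exponents `e (rev i) (rev j)`) in ★ p862713's matrix form at the swapped tuple `(r₂, s₂; r₁, s₁)`. [cite: BruhatTits1972, (6.4.9)] -/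
theorem mem_iff_of_rev (k : ↥(unitaryGroupOfForm σ J)) :
    k ∈ Jgw ↔ ∀ i j, Valued.v (((k : GL (Fin 3) K) : Matrix (Fin 3) (Fin 3) K) i j) ≤
      Valued.v ϖ ^ (![![0, r₂, s₂], ![r₁, 0, r₂], ![s₁, r₁, 0]] : Fin 3 → Fin 3 → ℕ) i j := by
  rw [hJgw]
  simp only [twoDepth_rev_apply]

/-! ## §2 The witness package on an upper shell -/

include hJ hσ hvσ hvϖ hJgw in
/-- **THE DEPTH-WITNESS PACKAGE ON AN UPPER SHELL** (the `hwit` binder of ★ p862617 `K2E3TwoDepthUpperShellTransport.exists_upperShell_witness_of_exists` and of K2E3-p34 (g2)'s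
CM dress, produced by the cover ★ p862713 at the swapped tuple).  Exponents as in ★ p862713 (`r₁ + r₂ = m + 1`, `s₁ + s₂ = k + 1`, `k ≤ m`, `1 ≤ m`, `|r₁ − r₂| ≤ 1`,
`|s₁ − s₂| ≤ 1`, aligned); `ū = ū(x, z)` with `z + σz + xσx = 0` and `1 ≤ |z|` (an upper shell lives over the big cell); `ū ∉ J_e` in entry form
(`¬(|x| ≤ |ϖ|^{r₂} ∧ |z| ≤ |ϖ|^{s₂})`) and `ū` off the sharp big cell (`¬(|x∕z| ≤ |ϖ|^{r₁} ∧ (|ϖ|^{s₁})⁻¹ ≤ |z|)`, ★ p862537's letters negated); `ū′ ∈ U(σ, Φ₃)` with matrix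
`ū(x∕z, z⁻¹)`; `c₁ ∈ 𝔭ᵐ`, `c₂ ∈ 𝔭ᵏ` `σ`-fixed; a trace-one `t`.  Then `∃ u″ ∈ N` with `ū′⁻¹ u″ ū′ ∈ Jgw` (the swapped group) and `(ū′⁻¹ u″ ū′)₀₀ = (1 + c)(1 + ε)`, `|ε| ≤ |ϖ|^{m+1}`,
`c = c₁ ∨ c = c₂`. [cite: Roche1998, §4] [cite: Casselman1995, §6.3] [cite: Serre1979, Ch. II §1] -/
theorem exists_upperShell_witness_package {m k : ℕ} (hm : 1 ≤ m) (hkm : k ≤ m) (hrr : r₁ + r₂ = m + 1) (hss : s₁ + s₂ = k + 1)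
    (hr1 : r₁ ≤ r₂ + 1) (hr2 : r₂ ≤ r₁ + 1) (hs1 : s₁ ≤ s₂ + 1) (hs2 : s₂ ≤ s₁ + 1) (hal : (r₁ ≤ r₂ ∧ s₁ ≤ s₂) ∨ (r₂ ≤ r₁ ∧ s₂ ≤ s₁))
    {nb' : ↥(unitaryGroupOfForm σ J)} {x z c₁ c₂ t : K} (hrel : z + σ z + x * σ x = 0) (hz : 1 ≤ Valued.v z)
    (hnb' : ((nb' : GL (Fin 3) K) : Matrix (Fin 3) (Fin 3) K) = !![1, 0, 0; -σ (x / z), 1, 0; z⁻¹, x / z, 1])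
    (hoff : ¬ (Valued.v x ≤ Valued.v ϖ ^ r₂ ∧ Valued.v z ≤ Valued.v ϖ ^ s₂))
    (hshal : ¬ (Valued.v (x / z) ≤ Valued.v ϖ ^ r₁ ∧ (Valued.v ϖ ^ s₁)⁻¹ ≤ Valued.v z))
    (hc₁ : Valued.v c₁ ≤ Valued.v ϖ ^ m) (hσc₂ : σ c₂ = c₂) (hc₂ : Valued.v c₂ ≤ Valued.v ϖ ^ k) (ht : t + σ t = 1) (hvt : Valued.v t ≤ 1) :
    ∃ u'' : ↥(unitaryGroupOfForm σ J), u'' ∈ unipotentU σ J ∧ nb'⁻¹ * u'' * nb' ∈ Jgw ∧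
      ∃ c ε : K, (c = c₁ ∨ c = c₂) ∧ Valued.v ε ≤ Valued.v ϖ ^ (m + 1) ∧
        (((nb'⁻¹ * u'' * nb' : ↥(unitaryGroupOfForm σ J)) : GL (Fin 3) K) : Matrix (Fin 3) (Fin 3) K) 0 0 = (1 + c) * (1 + ε) := by
  have hvϖ0 : Valued.v ϖ ≠ 0 := (Valuation.ne_zero_iff _).2 (CartanUnique.uniformizer_ne_zero hvϖ)
  have hz0 : z ≠ 0 := fun h => by
    rw [h, map_zero] at hz
    exact absurd hz (not_le.2 zero_lt_one)
  have hvz0 : 0 < Valued.v z := zero_lt_iff.2 ((Valuation.ne_zero_iff _).2 hz0)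
  -- the integral point `ū′ = ū(x∕z, z⁻¹)`: relation and `|z⁻¹| ≤ 1`
  have hrel' : z⁻¹ + σ z⁻¹ + x / z * σ (x / z) = 0 := K2E3LowerUnipotentBigCellIntegral.div_rel σ hrel hz0
  have hz1' : Valued.v z⁻¹ ≤ 1 := by rw [map_inv₀]; exact (inv_le_one₀ hvz0).2 hz
  -- the letters trade places
  have hoff' : ¬ (Valued.v (x / z) ≤ Valued.v ϖ ^ r₁ ∧ Valued.v z⁻¹ ≤ Valued.v ϖ ^ s₁) := fun h =>
    hshal ⟨h.1, (inv_le_comm₀ (pow_pos (zero_lt_iff.2 hvϖ0) _) hvz0).2 (by rw [← map_inv₀]; exact h.2)⟩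
  have hshal' : ¬ (Valued.v (x / z / z⁻¹) ≤ Valued.v ϖ ^ r₂ ∧ (Valued.v ϖ ^ s₂)⁻¹ ≤ Valued.v z⁻¹) := fun h =>
    hoff ⟨by rw [show x / z / z⁻¹ = x by field_simp] at h; exact h.1,
      (inv_le_inv₀ (pow_pos (zero_lt_iff.2 hvϖ0) _) hvz0).1 (by rw [← map_inv₀]; exact h.2)⟩
  have hal' : (r₂ ≤ r₁ ∧ s₂ ≤ s₁) ∨ (r₁ ≤ r₂ ∧ s₁ ≤ s₂) := hal.symm
  obtain ⟨u, huN, hj, c, ε, hc, hε, h00⟩ :=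
    K2E3TwoDepthDepthWitnessCover.exists_depth_witness_twoDepth σ hJ hσ hvσ hvϖ r₂ s₂ r₁ s₁ Jgw (mem_iff_of_rev σ r₁ s₁ r₂ s₂ Jgw hJgw)
      hm hkm (by omega) (by omega) hr2 hr1 hs2 hs1 hal' hnb' hrel' hz1' hoff' hshal' hc₁ hσc₂ hc₂ ht hvt
  exact ⟨u, huN, hj, c, ε, hc, hε, h00⟩

end Valuation

end Summit.HodgeConjecture.HodgeConjecture.Cruxes.H413.K2E3TwoDepthUpperShellCover

end
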